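import Summits.KontsevichZagierPeriods.KontsevichZagierPeriods.Theorems.ValuedFieldSpecialisationDefs

/-!
# Route ValuedFieldSpecialisation — crux `CTConstruction`: the constant term of a fibred normal form

Problem `KontsevichZagierPeriods`, route `ValuedFieldSpecialisation`, crux
stmt-KontsevichZagierPeriods-3495 (`CTConstruction`), line `registered`, stub
`stub_constantTermOfNormalForm'` (VALUE REALISATION of the constant-term map: clause (CT1) and the
value shadow `eval y = 0` of special-fibre rigidity).

Setting. A formal combination `x : KZ.FormalRep` is read through its slice function
`KZ.sliceEval x : ℝ → ℝ` (`[R] ↦ (s ↦ ∫_{x | (s,x) ∈ R.domain} R.integrand (s,x))`, additively).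
A *fibred normal form* of `x` is a congruence `x ≡ D + G (mod KZ.fibredRelations)` with `D` a
`ℤ`-combination of ELEMENTARY DIVERGENT PRODUCTS (`elementaryGenerators`: their slices over
`s ∈ (0,1)` are single divergent monomials `(-1)^b · r.value · s^(-p/q) · (log s)^b`) and `(G, y)`
in the subgroup of `FormalRep × FormalRep` generated by the DOMINATED PAIRS `([S], [r₀])`
(`KZ.IsDominatedFamily S r₀ g`: the slices of `S` tend to `r₀.value` as `s → 0⁺`, Lebesgue).

Main statement `stub_constantTermOfNormalForm'`: GIVEN (H3a) the exact slice of an elementary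
divergent product and (H3b) the log-power scale lemma along any non-trivial filter `l ≤ 𝓝[>] 0`
(the two neighbouring stubs of the line, taken here as hypotheses, verbatim), if `sliceEval x` has a
divergent-monomial expansion at `0⁺` with constant term `c` (`KZ.HasConstantTermAt`), then
`eval y = c`.

Proof. (1) `KZ.sliceEval_ae_eq_zero`: the slices of the fibred relation `x - D - G` vanish for
a.e. `s`, so `sliceEval x = sliceEval D + sliceEval G` on a co-null set `A`. (2) Closure induction
on `D` (`sliceEval_eq_sum_of_mem_closure_elementaryGenerators`): on `(0,1)`, `sliceEval D` is ONE
finite real combination of divergent monomials `s^a (log s)^b` (`a < 0`, or `a = 0 < b`). (3) Closure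
induction on the pair `(G, y)` (`tendsto_sliceEval_of_mem_closure_dominatedPairs`):
`sliceEval G s → eval y` as `s → 0⁺` (`KZ.IsDominatedFamily.tendsto_setIntegral`). (4) The filter
`l := 𝓝[>] 0 ⊓ 𝓟 A` is non-trivial (a co-null set meets every interval `(0, δ)`:
`Real.volume_Ioo`) and `≤ 𝓝[>] 0`. (5) Along `l` the difference of the two monomial families (that
of `D` and that of the expansion of `sliceEval x`), merged over `Fin k ⊕ Fin k'`, tends to
`c - eval y`; (H3b) forces `c - eval y = 0`.

Sources: M. Kontsevich, D. Zagier, *Periods* (2001), §1.2 (the moves; fibred reading is this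
route's); G. Comte, J.-M. Lion, J.-P. Rolin, Illinois J. Math. 44 (2000), Thm. 1 (log-power
monomials); T. Kaiser, Proc. LMS 116 (2017), Lemma 4.6 / Prop. 4.7 (dominant-exponent argument).
The statement itself is this route's (not in print); the argument is folklore real analysis.
Deliberately NOT here: (H3a), (H3b) themselves (neighbouring stubs `stub_elementarySliceValue`,
`stub_divergentMonomialsFilter`), existence of normal forms, special-fibre rigidity.
-/

noncomputable section

namespace Summit.KontsevichZagierPeriods.ValuedFieldSpecialisation

open MeasureTheory Set Filter
open scoped Topology
open Literature.NumberTheory.Transcendental Literature.NumberTheory.Transcendental.KZ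

/-- **Slices of an elementary combination are divergent-monomial sums.** Given (H3a) (the slice of
an elementary divergent product `P(p,q,b,d,r)` over `s ∈ (0,1)` is
`(-1)^b · r.value · s^(-p/q) · (log s)^b`), every `D` in the subgroup generated by
`elementaryGenerators` has, on `(0,1)`, slice function EQUAL to one finite real combination
`∑ i, w i * s ^ (a i) * (log s) ^ (b i)` of DIVERGENT monomials (`a i < 0`, or `a i = 0 < b i`):
closure induction (`0 < q ∧ (0 < p ∨ 0 < b)` makes `(-p/q, b)` divergent; sums concatenate over
`Fin (k₁ + k₂)`, negation negates the weights). [folklore] -/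
theorem sliceEval_eq_sum_of_mem_closure_elementaryGenerators
    (H3a : ∀ (p q b d : ℕ) (r : IntegralRep d) (P : IntegralRep (b + d + 1 + 1)), 0 < q →
      P.domain = {z | ∃ (s u : ℝ) (y : Fin b → ℝ) (w : Fin d → ℝ),
        z = Matrix.vecCons s (Matrix.vecCons u (Fin.append y w)) ∧ 0 < s ∧ s < 1 ∧ 0 < u ∧
          u ^ q * s ^ p < 1 ∧ (∀ j, s ≤ y j ∧ y j ≤ 1) ∧ w ∈ r.domain} →
      P.integrand = (fun z => (∏ j : Fin b, (z (Fin.castAdd d j).succ.succ)⁻¹) *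
        r.integrand (fun l : Fin d => z (Fin.natAdd b l).succ.succ)) →
      ∀ s ∈ Set.Ioo (0 : ℝ) 1, sliceValue P s =
        (-1) ^ b * r.value * s ^ (((-(p : ℚ) / q : ℚ)) : ℝ) * Real.log s ^ b)
    {D : FormalRep} (hD : D ∈ AddSubgroup.closure elementaryGenerators) :
    ∃ (k : ℕ) (a : Fin k → ℝ) (b : Fin k → ℕ) (w : Fin k → ℝ),
      (∀ i, a i < 0 ∨ (a i = 0 ∧ 0 < b i)) ∧
      ∀ s ∈ Ioo (0 : ℝ) 1, sliceEval D s = ∑ i, w i * s ^ (a i) * Real.log s ^ (b i) := by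
  induction hD using AddSubgroup.closure_induction with
  | mem x hx =>
    obtain ⟨p, q, b, d, r, P, hq, hpb, hdom, hint, rfl⟩ := hx
    refine ⟨1, fun _ => (((-(p : ℚ) / q : ℚ)) : ℝ), fun _ => b, fun _ => (-1) ^ b * r.value,
      fun _ => ?_, fun s hs => ?_⟩
    · rcases Nat.eq_zero_or_pos p with hp | hp
      · subst hp
        refine Or.inr ⟨?_, hpb.resolve_left (lt_irrefl 0)⟩
        push_cast
        simp
      · left
        push_cast
        exact div_neg_of_neg_of_pos (neg_lt_zero.mpr (Nat.cast_pos.mpr hp)) (Nat.cast_pos.mpr hq)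
    · rw [sliceEval_of, H3a p q b d r P hq hdom hint s hs, Fin.sum_univ_one]
  | zero => exact ⟨0, Fin.elim0, Fin.elim0, Fin.elim0, fun i => i.elim0, fun s _ => by simp⟩
  | add u v _ _ hu hv =>
    obtain ⟨k₁, a₁, b₁, w₁, hab₁, h₁⟩ := hu
    obtain ⟨k₂, a₂, b₂, w₂, hab₂, h₂⟩ := hv
    refine ⟨k₁ + k₂, Fin.append a₁ a₂, Fin.append b₁ b₂, Fin.append w₁ w₂, fun i => ?_,
      fun s hs => ?_⟩
    · induction i using Fin.addCases with
      | left i => simpa only [Fin.append_left] using hab₁ i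
      | right j => simpa only [Fin.append_right] using hab₂ j
    · rw [map_add, Pi.add_apply, h₁ s hs, h₂ s hs, Fin.sum_univ_add]
      simp only [Fin.append_left, Fin.append_right]
  | neg u _ hu =>
    obtain ⟨k, a, b, w, hab, h⟩ := hu
    refine ⟨k, a, b, fun i => -w i, hab, fun s hs => ?_⟩
    rw [map_neg, Pi.neg_apply, h s hs, ← Finset.sum_neg_distrib]
    simp only [neg_mul]

/-- **Slices of a dominated combination converge to the value of its special-fibre combination.**
For `(G, y)` in the subgroup of `FormalRep × FormalRep` generated by the dominated pairs
`([S], [r₀])` (`KZ.IsDominatedFamily S r₀ g`), `sliceEval G s → eval y` as `s → 0⁺`: on a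
generator this is Lebesgue's dominated convergence `KZ.IsDominatedFamily.tendsto_setIntegral`
(`sliceEval [S] = sliceValue S`, `eval [r₀] = r₀.value`), and both sides are additive.
[Kontsevich–Zagier 2001, §1.2; Lebesgue] [folklore] -/
theorem tendsto_sliceEval_of_mem_closure_dominatedPairs {v : FormalRep × FormalRep}
    (hv : v ∈ AddSubgroup.closure {v : FormalRep × FormalRep | ∃ (n : ℕ) (S : IntegralRep (n + 1))
      (r₀ g : IntegralRep n), IsDominatedFamily S r₀ g ∧ v = (of S, of r₀)}) :
    Tendsto (sliceEval v.1) (𝓝[>] 0) (𝓝 (eval v.2)) := by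
  induction hv using AddSubgroup.closure_induction with
  | mem v hv =>
    obtain ⟨n, S, r₀, g, hS, rfl⟩ := hv
    dsimp only
    rw [sliceEval_of, eval_of]
    exact hS.tendsto_setIntegral
  | zero =>
    rw [Prod.fst_zero, Prod.snd_zero, map_zero, map_zero]
    exact tendsto_const_nhds
  | add u v _ _ hu hv =>
    rw [Prod.fst_add, Prod.snd_add, map_add, map_add]
    exact hu.add hv
  | neg u _ hu =>
    rw [Prod.fst_neg, Prod.snd_neg, map_neg, map_neg]
    exact hu.neg

/-- The trace on a co-null set `A ⊆ ℝ` of the right-neighbourhood filter of `0` is non-trivial: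
every member of `𝓝[>] 0` contains an interval `(0, δ)`, of Lebesgue measure `δ > 0`, which a null
complement cannot cover. [folklore] -/
theorem nhdsGT_inf_principal_neBot_of_volume_compl_eq_zero {A : Set ℝ} (hA : volume Aᶜ = 0) :
    (𝓝[>] (0 : ℝ) ⊓ 𝓟 A).NeBot := by
  refine inf_principal_neBot_iff.2 fun U hU => ?_
  obtain ⟨δ, hδ, hUδ⟩ := mem_nhdsGT_iff_exists_Ioo_subset.1 hU
  by_contra hne
  have hsub : Ioo (0 : ℝ) δ ⊆ Aᶜ := fun s hs hsA => hne ⟨s, hUδ hs, hsA⟩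
  have h0 : volume (Ioo (0 : ℝ) δ) = 0 := measure_mono_null hsub hA
  rw [Real.volume_Ioo, sub_zero, ENNReal.ofReal_eq_zero] at h0
  exact absurd h0 (not_le.2 hδ)

/-- **Constant term of a fibred normal form** (crux `CTConstruction`, stmt-KontsevichZagierPeriods-3495,
line `registered`, stub `stub_constantTermOfNormalForm'` — value realisation for (CT1) and the
value shadow of special-fibre rigidity). Hypotheses, verbatim the two neighbouring stubs: (H3a) the
slice over `s ∈ (0,1)` of an elementary divergent product `P(p,q,b,d,r)` is
`(-1)^b · r.value · s^(-p/q) · (log s)^b`; (H3b) a finite real combination of divergent monomials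
`s^a (log s)^b` (`a < 0`, or `a = 0 < b`) with a finite limit `d` along a non-trivial filter
`l ≤ 𝓝[>] 0` has `d = 0`. Conclusion: if `sliceEval x` has a divergent-monomial expansion at `0⁺`
with constant term `c`, `D` is a `ℤ`-combination of elementary divergent products, `(G, y)` lies in
the subgroup generated by the dominated pairs `([S], [r₀])`, and `x - D - G ∈ KZ.fibredRelations`,
then `eval y = c`. Proof: slices of fibred relations vanish a.e. (`KZ.sliceEval_ae_eq_zero`), so
along the non-trivial filter `𝓝[>] 0 ⊓ 𝓟 {s | sliceEval x s = sliceEval D s + sliceEval G s}` the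
merged monomial family tends to `c - eval y`, and (H3b) gives `c = eval y`.
[Kontsevich–Zagier 2001, §1.2; Comte–Lion–Rolin 2000, Thm. 1; Kaiser 2017, Prop. 4.7] [folklore] -/
theorem stub_constantTermOfNormalForm' : (∀ (p q b d : ℕ) (r : Literature.NumberTheory.Transcendental.KZ.IntegralRep d) (P : Literature.NumberTheory.Transcendental.KZ.IntegralRep (b + d + 1 + 1)), 0 < q → P.domain = {z | ∃ (s u : ℝ) (y : Fin b → ℝ) (w : Fin d → ℝ), z = Matrix.vecCons s (Matrix.vecCons u (Fin.append y w)) ∧ 0 < s ∧ s < 1 ∧ 0 < u ∧ u ^ q * s ^ p < 1 ∧ (∀ j, s ≤ y j ∧ y j ≤ 1) ∧ w ∈ r.domain} → P.integrand = (fun z => (∏ j : Fin b, (z (Fin.castAdd d j).succ.succ)⁻¹) * r.integrand (fun l : Fin d => z (Fin.natAdd b l).succ.succ)) → ∀ s ∈ Set.Ioo (0 : ℝ) 1, Literature.NumberTheory.Transcendental.KZ.sliceValue P s = (-1) ^ b * r.value * s ^ (((-(p : ℚ) / q : ℚ)) : ℝ) * Real.log s ^ b) → (∀ (ι : Type) [Fintype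 ι] (a : ι → ℝ) (b : ι → ℕ) (w : ι → ℝ) (d : ℝ) (l : Filter ℝ), l.NeBot → l ≤ nhdsWithin (0 : ℝ) (Set.Ioi 0) → (∀ i, a i < 0 ∨ (a i = 0 ∧ 0 < b i)) → Filter.Tendsto (fun s : ℝ => ∑ i, w i * s ^ (a i) * Real.log s ^ (b i)) l (nhds d) → d = 0) → ∀ (x : Literature.NumberTheory.Transcendental.KZ.FormalRep) (c : ℝ), Literature.NumberTheory.Transcendental.KZ.HasConstantTermAt (Literature.NumberTheory.Transcendental.KZ.sliceEval x) c → ∀ D ∈ AddSubgroup.closure Summit.KontsevichZagierPeriods.ValuedFieldSpecialisation.elementaryGenerators, ∀ (G y : Literature.NumberTheory.Transcendental.KZ.FormalRep), (G, y) ∈ AddSubgroup.closure {v : Literature.NumberTheory.Transcendental.KZ.FormalRep × Literature.NumberTheory.Transcendental.KZ.FormalRep | ∃ (n : ℕ) (S : Literature.NumberTheory.Transcendental.KZ.IntegralRep (n + 1)) (r₀ g : Literature.NumberTheory.Transcendental.KZ.IntegralRep n), Literature.NumberTheory.Transcendental.KZ.IsDominatedFamily S r₀ g ∧ v = (Literature.NumberTheory.Transcendental.KZ.of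 S, Literature.NumberTheory.Transcendental.KZ.of r₀)} → x - D - G ∈ Literature.NumberTheory.Transcendental.KZ.fibredRelations → Literature.NumberTheory.Transcendental.KZ.eval y = c := by
  intro H3a H3b x c hx D hD G y hGy hrel
  -- (1) the slices of the fibred relation `x - D - G` vanish for a.e. `s`
  have hae : ∀ᵐ s : ℝ, sliceEval x s - sliceEval D s - sliceEval G s = 0 := by
    filter_upwards [sliceEval_ae_eq_zero hrel] with s hs
    simpa only [map_sub, Pi.sub_apply, Pi.zero_apply] using hs
  have hAc : volume {s : ℝ | sliceEval x s - sliceEval D s - sliceEval G s = 0}ᶜ = 0 := by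
    rw [compl_setOf]
    exact ae_iff.1 hae
  -- (2) the slices of `D` on `(0, 1)`: one finite sum of divergent monomials
  obtain ⟨k, a, b, w, hab, hDsum⟩ := sliceEval_eq_sum_of_mem_closure_elementaryGenerators H3a hD
  -- (3) the slices of `G` tend to `eval y`
  have hG : Tendsto (sliceEval G) (𝓝[>] 0) (𝓝 (eval y)) :=
    tendsto_sliceEval_of_mem_closure_dominatedPairs hGy
  -- (4) the right-neighbourhood filter of `0` traced on the a.e. set
  have hl := nhdsGT_inf_principal_neBot_of_volume_compl_eq_zero hAc
  have hle : 𝓝[>] (0 : ℝ) ⊓ 𝓟 {s : ℝ | sliceEval x s - sliceEval D s - sliceEval G s = 0} ≤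
      𝓝[>] (0 : ℝ) := inf_le_left
  -- (5) along it, the merged monomial family tends to `c - eval y`
  obtain ⟨k', a', b', w', hab', hxc⟩ := hx
  have hev : ∀ᶠ s in 𝓝[>] (0 : ℝ) ⊓ 𝓟 {s : ℝ | sliceEval x s - sliceEval D s - sliceEval G s = 0},
      sliceEval x s - sliceEval G s = ∑ i, w i * s ^ (a i) * Real.log s ^ (b i) := by
    have h1 : ∀ᶠ s in 𝓝[>] (0 : ℝ) ⊓ 𝓟 {s : ℝ | sliceEval x s - sliceEval D s - sliceEval G s = 0},
        sliceEval x s - sliceEval D s - sliceEval G s = 0 :=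
      mem_inf_of_right (mem_principal_self _)
    have h2 : ∀ᶠ s in 𝓝[>] (0 : ℝ) ⊓ 𝓟 {s : ℝ | sliceEval x s - sliceEval D s - sliceEval G s = 0},
        s ∈ Ioo (0 : ℝ) 1 :=
      mem_inf_of_left (Ioo_mem_nhdsGT one_pos)
    filter_upwards [h1, h2] with s hs1 hs2
    rw [← hDsum s hs2]
    linarith
  let α : Fin k ⊕ Fin k' → ℝ := Sum.elim a fun j => ((a' j : ℚ) : ℝ)
  let β : Fin k ⊕ Fin k' → ℕ := Sum.elim b b'
  let W : Fin k ⊕ Fin k' → ℝ := Sum.elim w fun j => -w' j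
  have hdiv : ∀ i, α i < 0 ∨ (α i = 0 ∧ 0 < β i) := by
    rintro (i | j)
    · simp only [α, β, Sum.elim_inl]
      exact hab i
    · simp only [α, β, Sum.elim_inr]
      exact_mod_cast hab' j
  have key : Tendsto (fun s : ℝ => ∑ i, W i * s ^ (α i) * Real.log s ^ (β i))
      (𝓝[>] (0 : ℝ) ⊓ 𝓟 {s : ℝ | sliceEval x s - sliceEval D s - sliceEval G s = 0})
      (𝓝 (c - eval y)) := by
    refine ((hxc.mono_left hle).sub (hG.mono_left hle)).congr' ?_
    filter_upwards [hev] with s hs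
    simp only [α, β, W, Fintype.sum_sum_type, Sum.elim_inl, Sum.elim_inr, neg_mul,
      Finset.sum_neg_distrib]
    linarith
  have h0 := H3b (Fin k ⊕ Fin k') α β W (c - eval y) _ hl hle hdiv key
  linarith

end Summit.KontsevichZagierPeriods.ValuedFieldSpecialisation
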